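import Summits.HodgeConjecture.HodgeConjecture.Theorems.Ring2AbelianAllEllipticPowerCarriersDefs
import Summits.HodgeConjecture.HodgeConjecture.Theorems.VHCAbelianSchemesRoadEllipticPowerAnchors
import Summits.HodgeConjecture.HodgeConjecture.Theorems.Ring2DeformCompactPencils
import Summits.HodgeConjecture.HodgeConjecture.Theses.VHCAbelianSchemesRoad
import HarnessLib

/-!
# Ring 2 / AbelianAll (André column) — `HC_CM` FROM TWISTED CARRIERS FOR LEFSCHETZ CLASSES ON ELLIPTIC POWERS; `HC_AV` FROM CARRIERS FOR
# ALGEBRAIC CLASSES AT CM AND ELLIPTIC-POWER ANCHORS ONLY, `HC_CM` IDLE — the rows of PART AB-d on the cell's named decls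

research route, not a corollary; conditional on HC_CM plus one named minimal statement.

PART AB-c landed the rows `X := CMAlgebraicTwistedCarriers` (`HC_CM` LOAD-BEARING) and `X := AbelianTwistedDesigns` (`HC_CM` idle, but a
statement about ALL polarised abelian varieties). PART AB-d (`VHCAbelianSchemesRoadEllipticPowerAnchors`, road side) used clause (ii) of
André's Lemme 6.3.3 — now the Literature named fact `Andre1996.andre1996_cmHodgeClasses_ellipticPowerPencils` — to localise the `HC_CM` step
to ELLIPTIC-POWER anchors, where every served class is a known Lefschetz class. This file states the resulting rows on the NAMED decls
(`PadicSemiregularLift.HodgeAbelianVarieties` = `HC_AV`, `RankFourFaces.CMAbelianHodge` = `HC_CM`, the road's binders `ChernCharacterOnBetti`,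
`TwistedPerfectDoor`, `AndreCMAnchoredPencil`, and the nodes `CMAlgebraicTwistedCarriers` (AB-b), `EllipticPowerAlgebraicTwistedCarriers`
(AB-e), `AbelianTwistedDesigns` (AB-b)):

* §1 **`HC_CM_of_ellipticPowerAlgebraicTwistedCarriers : K-C → TwistedPerfectDoor → andre1996_cmHodgeClasses_ellipticPowerPencils →
  EllipticPowerAlgebraicTwistedCarriers → HC_CM`** — `HC_CM` from semiregular twisted representatives, modulo the `θ`-ray, of LEFSCHETZ classes
  on abelian varieties isogenous to powers of elliptic curves (door-generic form first).
* §2 **`HC_AV_of_cmAlgebraic_and_ellipticPower_twistedCarriers : K-C → TwistedPerfectDoor → AndreCMAnchoredPencil →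
  andre1996_cmHodgeClasses_ellipticPowerPencils → CMAlgebraicTwistedCarriers → EllipticPowerAlgebraicTwistedCarriers → HC_AV`** — the André
  column's `B_min` of gen 59: carriers for KNOWN ALGEBRAIC classes at CM anchors (`2 ≤ p`, `2p + 4 ≤ n`) and at elliptic-power anchors
  (`2 ≤ p ≤ n − 2`) ONLY; `HC_CM` IDLE (it is §1's conclusion); no cell of K-SR♭∃, no curve residual; the refined #22 in place of #22.
* §3 Lattice: `AbelianDesigns 𝒪 ⟹ EllipticPowerAlgebraicCarriers 𝒪` (restriction), twisted form; so the row of §2 REFINES AB-c's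
  `HC_AV_of_abelianTwistedDesigns` (fewer anchors) granted the refined fact.

HONEST: every carrier node is OPEN, not in print and NOT implied by the Hodge conjecture (which holds on elliptic powers: a carrier is more than
algebraicity); `andre1996_cmHodgeClasses_ellipticPowerPencils` is a THEOREM IN PRINT entering BY NAME (not a route binder — the road's binder
#22 is the weaker `AndreAnchoredPencilsAlgebraic`, which it implies); Lemme 6.3.1 and the door are the road's binders. Nothing here says any
carrier, door, `HC_CM`, `HC_AV` or HC holds. References: [cite: Andre1996Motifs, §6.3 Lemmes 6.3.1–6.3.3 (pp. 31–33)]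
[cite: vanGeemen1994HodgeAV, Lemma 3.7 and Thm. 4.3] [cite: Bloch1972Semiregularity, Remark (7.5)] [cite: BuchweitzFlenner2003, §5 Thm. 5.1]
[cite: Pridham2024Semiregularity, Cor. 2.25 and Rem. 2.27] [cite: Milne1999, §7 p. 72].
-/

noncomputable section

open CategoryTheory CategoryTheory.Limits AlgebraicGeometry Topology

namespace Summit.HodgeConjecture.HodgeConjecture.Ring2.AbelianAll

-- the cell's namespace repeats the summit name (`Summit.HodgeConjecture.HodgeConjecture…`), as in every `Ring2*` file
set_option linter.dupNamespace false

open Literature.AlgebraicGeometry Literature.AlgebraicGeometry.Motives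
open Literature.AlgebraicGeometry.HodgeTheory
open Literature.AlgebraicTopology.SingularHomology
open Literature.AlgebraicGeometry.Milne1999 (IsOfCMType CMHodgeHypothesisAt)
open Literature.AlgebraicGeometry.Andre1996 (andre1996_cmAnchoredPencil andre1996_cmHodgeClasses_algebraicallyAnchoredPencils
  andre1996_cmHodgeClasses_ellipticPowerPencils)
open Summit.Ventures.HSemireg (ObjClass LocalVariationalHodgeFor)
open Summit.HodgeConjecture.HodgeConjecture.Theses
open Summit.HodgeConjecture.HodgeConjecture.Ring2.SemiregularRepresentatives (AnchoredCarrierAt PinnedDesignAt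
  twistedPerfectDoorVHC_iff_localVariationalHodgeFor cmHodgeHypothesisAt_of_ellipticPowerPencils_of_door_of_anchoredCarrierAt
  forall_hodgeConjectureFor_of_andre1996_of_ellipticPowerPencils_of_door_of_carriers ellipticPowerAlgebraicCarrierAt_of_pinnedDesignAt
  cmAlgebraicCarrierAt_of_pinnedDesignAt andre1996_cmHodgeClasses_algebraicallyAnchoredPencils_of_ellipticPowerPencils)

/-! ## §1 `HC_CM` from carriers for Lefschetz classes on elliptic powers -/

/-- **`HC_CM` from the refined Lemmes 6.3.2–6.3.3, the door's local variational Hodge statement and CARRIERS FOR ALGEBRAIC CLASSES AT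
ELLIPTIC-POWER ANCHORS** (door-generic; cell-free; residual-free). [cite: Andre1996Motifs, Lemme 6.3.3 (ii) (p. 33) and §6.3 b), c)]
[cite: vanGeemen1994HodgeAV, Thm. 4.3] [cite: BuchweitzFlenner2003, §5 Thm. 5.1] [cite: Milne1999, §7 p. 72] -/
theorem HC_CM_of_ellipticPowerPencils_of_door_of_ellipticPowerAlgebraicCarriers (h₂₂ : andre1996_cmHodgeClasses_ellipticPowerPencils)
    {𝒪 : ObjClass} (hT : LocalVariationalHodgeFor 𝒪) (hB : EllipticPowerAlgebraicCarriers 𝒪) : RankFourFaces.CMAbelianHodge :=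
  fun B hB' hcm ↦ cmHodgeHypothesisAt_of_ellipticPowerPencils_of_door_of_anchoredCarrierAt h₂₂ hT (fun d p h2 h4 ↦ hB d p h2 h4) B hB' hcm

/-- **`HC_CM ⟸ K-C ∧ TwistedPerfectDoor ∧ andre1996_cmHodgeClasses_ellipticPowerPencils ∧ EllipticPowerAlgebraicTwistedCarriers`** — the road's
binders BY NAME, the refined #22 BY NAME, and the node of PART AB-e: the Hodge conjecture for CM abelian varieties from semiregular twisted
representatives, modulo the `θ`-ray, of LEFSCHETZ classes on abelian varieties isogenous to powers of elliptic curves.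
[cite: Andre1996Motifs, Lemme 6.3.3 (ii) (p. 33)] [cite: Pridham2024Semiregularity, Cor. 2.25 and Rem. 2.27] [cite: vanGeemen1994HodgeAV, Thm. 4.3]
[cite: Bloch1972Semiregularity, Remark (7.5)] -/
theorem HC_CM_of_ellipticPowerAlgebraicTwistedCarriers (hC : VHCAbelianSchemesRoad.ChernCharacterOnBetti)
    (hDoor : VHCAbelianSchemesRoad.TwistedPerfectDoor) (h₂₂ : andre1996_cmHodgeClasses_ellipticPowerPencils)
    (hB : EllipticPowerAlgebraicTwistedCarriers) : RankFourFaces.CMAbelianHodge := by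
  obtain ⟨C⟩ := (hC : Nonempty ChernCharacterBetti)
  exact HC_CM_of_ellipticPowerPencils_of_door_of_ellipticPowerAlgebraicCarriers h₂₂
    ((twistedPerfectDoorVHC_iff_localVariationalHodgeFor C _).1 (hDoor C)) (hB C)

/-! ## §2 `HC_AV` from carriers for algebraic classes at CM and elliptic-power anchors only, `HC_CM` idle -/

/-- **`HC_AV` from Lemme 6.3.1, the refined Lemmes 6.3.2–6.3.3, the door, CM-algebraic carriers and elliptic-power-algebraic carriers**
(door-generic; `HC_CM` is the intermediate conclusion of §1). [cite: Andre1996Motifs, §6.3 Lemmes 6.3.1–6.3.3 (pp. 31–33)]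
[cite: vanGeemen1994HodgeAV, Thm. 4.3] [cite: Bloch1972Semiregularity, Remark (7.5)] [cite: Milne1999, §7 p. 72] -/
theorem HC_AV_of_andre1996_of_door_of_cmAlgebraic_of_ellipticPowerAlgebraicCarriers (h₂₁ : andre1996_cmAnchoredPencil)
    (h₂₂ : andre1996_cmHodgeClasses_ellipticPowerPencils) {𝒪 : ObjClass} (hT : LocalVariationalHodgeFor 𝒪) (hcm : CMAlgebraicCarriers 𝒪)
    (hell : EllipticPowerAlgebraicCarriers 𝒪) : PadicSemiregularLift.HodgeAbelianVarieties :=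
  fun A ↦ forall_hodgeConjectureFor_of_andre1996_of_ellipticPowerPencils_of_door_of_carriers h₂₁ h₂₂ hT (fun n p h2 h4 ↦ hcm n p h2 h4)
    (fun d p h2 h4 ↦ hell d p h2 h4) A

/-- **`HC_AV ⟸ K-C ∧ TwistedPerfectDoor ∧ AndreCMAnchoredPencil ∧ andre1996_cmHodgeClasses_ellipticPowerPencils ∧ CMAlgebraicTwistedCarriers ∧
EllipticPowerAlgebraicTwistedCarriers`** — THE ANDRÉ COLUMN'S `B_min` OF GEN 59: semiregular twisted representatives, modulo the `θ`-ray, of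
KNOWN ALGEBRAIC classes (i) of codimension `2 ≤ p`, `2p + 4 ≤ n` on polarised CM abelian `n`-folds and (ii) of codimension `2 ≤ p ≤ n − 2` on
polarised abelian `n`-folds isogenous to powers of elliptic curves (Lefschetz classes there). `HC_CM` IDLE; no cell of K-SR♭∃; no curve
residual; the refined #22 (clause (ii) recorded) in place of the route binder #22, which it implies. [cite: Andre1996Motifs, §6.3 (pp. 31–33)]
[cite: Pridham2024Semiregularity, Cor. 2.25 and Rem. 2.27] [cite: vanGeemen1994HodgeAV, Thm. 4.3] [cite: Bloch1972Semiregularity, Remark (7.5)] -/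
theorem HC_AV_of_cmAlgebraic_and_ellipticPower_twistedCarriers (hC : VHCAbelianSchemesRoad.ChernCharacterOnBetti)
    (hDoor : VHCAbelianSchemesRoad.TwistedPerfectDoor) (h₂₁ : VHCAbelianSchemesRoad.AndreCMAnchoredPencil)
    (h₂₂ : andre1996_cmHodgeClasses_ellipticPowerPencils) (hcm : CMAlgebraicTwistedCarriers) (hell : EllipticPowerAlgebraicTwistedCarriers) :
    PadicSemiregularLift.HodgeAbelianVarieties := by
  obtain ⟨C⟩ := (hC : Nonempty ChernCharacterBetti)
  exact HC_AV_of_andre1996_of_door_of_cmAlgebraic_of_ellipticPowerAlgebraicCarriers h₂₁ h₂₂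
    ((twistedPerfectDoorVHC_iff_localVariationalHodgeFor C _).1 (hDoor C)) (hcm C) (hell C)

/-- **The refined fact discharges the road's binder #22** (`AndreAnchoredPencilsAlgebraic`), so rows stated with the binder are available
from it. [cite: Andre1996Motifs, Lemmes 6.3.2–6.3.3 (pp. 32–33)] -/
theorem andreAnchoredPencilsAlgebraic_of_ellipticPowerPencils (h₂₂ : andre1996_cmHodgeClasses_ellipticPowerPencils) :
    VHCAbelianSchemesRoad.AndreAnchoredPencilsAlgebraic :=
  andre1996_cmHodgeClasses_algebraicallyAnchoredPencils_of_ellipticPowerPencils h₂₂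

/-! ## §3 Lattice: the designs node dominates the elliptic-power node -/

/-- `AbelianDesigns 𝒪 ⟹ EllipticPowerAlgebraicCarriers 𝒪` (restriction of the pinned designs to elliptic-power anchors).
[cite: Bloch1972Semiregularity, Remark (7.5)] [cite: vanGeemen1994HodgeAV, Thm. 4.3] -/
theorem ellipticPowerAlgebraicCarriers_of_abelianDesigns {𝒪 : ObjClass} (h : AbelianDesigns 𝒪) : EllipticPowerAlgebraicCarriers 𝒪 :=
  fun n p h2 h4 ↦ ellipticPowerAlgebraicCarrierAt_of_pinnedDesignAt (h n p h2 h4)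

/-- Twisted form: `AbelianTwistedDesigns ⟹ CMAlgebraicTwistedCarriers ∧ EllipticPowerAlgebraicTwistedCarriers` — the `B_min` of §2 is implied by
AB-c's designs node. [cite: Bloch1972Semiregularity, Remark (7.5)] [cite: Markman2025SecantWeil, §7.3] -/
theorem cmAlgebraic_and_ellipticPower_twistedCarriers_of_abelianTwistedDesigns (h : AbelianTwistedDesigns) :
    CMAlgebraicTwistedCarriers ∧ EllipticPowerAlgebraicTwistedCarriers :=
  ⟨fun C n p h2 h4 ↦ cmAlgebraicCarrierAt_of_pinnedDesignAt (h C n p h2 (by omega)),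
    fun C ↦ ellipticPowerAlgebraicCarriers_of_abelianDesigns (h C)⟩

/-- **AB-c's designs row recovered through the two anchor families** (granted the refined fact): K-C ∧ door ∧ #21 ∧ refined #22 ∧
`AbelianTwistedDesigns` ⟹ `HC_AV`, factoring through §2. [cite: Andre1996Motifs, §6.3 (pp. 31–33)] [cite: Bloch1972Semiregularity, Remark (7.5)] -/
theorem HC_AV_of_abelianTwistedDesigns_of_ellipticPowerPencils (hC : VHCAbelianSchemesRoad.ChernCharacterOnBetti)
    (hDoor : VHCAbelianSchemesRoad.TwistedPerfectDoor) (h₂₁ : VHCAbelianSchemesRoad.AndreCMAnchoredPencil)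
    (h₂₂ : andre1996_cmHodgeClasses_ellipticPowerPencils) (hD : AbelianTwistedDesigns) : PadicSemiregularLift.HodgeAbelianVarieties :=
  HC_AV_of_cmAlgebraic_and_ellipticPower_twistedCarriers hC hDoor h₂₁ h₂₂ (cmAlgebraic_and_ellipticPower_twistedCarriers_of_abelianTwistedDesigns hD).1
    (cmAlgebraic_and_ellipticPower_twistedCarriers_of_abelianTwistedDesigns hD).2

end Summit.HodgeConjecture.HodgeConjecture.Ring2.AbelianAll

end
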